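import Literature.MathematicalPhysics.QuantumFieldTheory.Balaban1983to89.B5G115RowSum

/-!
# B5 (1.110), first entry, in COMPOSABLE row-sum currency for `G = Δ_1⁻¹` on the torus (a = 1, U = 1):
# per-block `ℓ¹` row sums decaying in the block distance, and exponentially WEIGHTED row sums bounded
# uniformly in `n = L^k` and in the volume

Source: T. Bałaban, *Propagators and renormalization transformations for lattice gauge theories. I*,
Commun. Math. Phys. **95** (1984) 17–40 (`Balaban1984PropagatorsI`, "B5"), Sect. F, pp. 35–36 [PDF 19–20];
renders `b2b-balaban-ref1/pages/1984-cmp95-propagators-rt-I/…-p019-x2.png` (journal p. 35) and `…-p020-x2.png`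
(journal p. 36) read as images this session.  A kernel-checked SUPPLEMENT to PUBLISHED work under line-by-line
audit by the pub-balaban cell; value = kernel certificate, NOT summit progress.

WHAT THE PAPER PRINTS (verbatim).  p. 35, Prop. 1.2: «There exists a positive constant δ₀ depending on d only,
such that |(GJ)(x)|, |(∇GJ)(x)|, |(G∇*J)(x)|, |(ΔGJ)(x)| ≤ O(1)e^{−δ₀|y−y′|}|J| (1.110) for x ∈ Δ̃(y),
supp J ⊂ Δ̃(y′), with the constant O(1) depending on d only,»; «Cubes Δ(y) are simply unit cubes of T_η, or
Δ(y) = B^k(y), y ∈ T₁^{(k)}.»; (1.108) «|A| = max_μ sup_x |A_μ(x)|,».  p. 36: «The localized inequalities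
(1.110)–(1.114) imply immediately the following global inequalities |GJ|, … ≤ O(1)|J|, (1.115)».  p. 30 (1.71):
«Δ_a⁻¹ = G_k, or simply G» (typed in `B5DeltaA169`).

CITATION HEADER (cell ABSOLUTE RULE).  Nothing of B5 is used as a hypothesis and no internally-minted
statement enters as a cited fact: every declaration below is kernel-proved from the tree ([folklore]); the page
references are TEXT LOCATIONS of what is being supplemented.

WHAT IS TYPED HERE (zero sorry).  Write `G = (DeltaA n M 1)⁻¹`, `i = (n·y + r, μ)` a row, `B(y′)` the block
(unit cube) of `y′ ∈ T₁`, `T = |y − y′|_{T₁,∞}` (`torusSupNorm M (rep y − rep y′)`), and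
`δ₁ = 1/(2(d+1))`, `C₁ = 2N·2^N·e^{δ₁}`, `δ₂ = κ₁₈₃(d+1)/(d+1)`, `C₂ = MD183(d+1,N)·periodConst(κ₁₈₃(d+1),d)`
(the constants of `B5G183FreeRowSum`, functions of `d`, `N` only).
* §1 `sum_blockOf_mul` — the block swap `Σ_j w(blockOf j)·F(j) = Σ_{y′} w(y′)·Σ_j 1_{B(y′)}(j)F(j)`.
* §2 **`block_row_sum_le`** — the FIRST ENTRY of (1.110) in `ℓ¹` row-sum currency with unit cubes:
  `Σ_{j ∈ B(y′)×dirs} |G(i,j)| ≤ C₁e^{−δ₁T} + (d+1)·C₂e^{−δ₂T}`, by `ℓ¹`–`ℓ^∞` duality PER BLOCK: the localized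
  operator bound `B5G183FreeRowSum.norm_DeltaA_one_inv_mulVec_le_uniform` (BY NAME) tested against the phase field
  `conj G(i,·)/|G(i,·)|` restricted to `B(y′)` (support hypothesis from `B5G115SupBound.piece_supp`).
* §3 **`weighted_row_sum_le`** / `weighted_row_sum_le'` — for every `δ′ < min(δ₁, δ₂)` and every row,
  `Σ_j e^{δ′|y − blockOf(j)|_{T₁,∞}} |G(i,j)| ≤ C₁·K_{d+1}(δ₁ − δ′) + (d+1)·C₂·K_{d+1}(δ₂ − δ′)`,
  `K = B4Sect5Proof.latticeConst`, UNIFORM in `n = L^k` and in the torus (block swap, §2, and the uniform torus sum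
  `B5Hk163TorusHolderRate.sum_exp_torusSupNorm_sub_rep_le` BY NAME at the two reduced rates) — the exponentially
  weighted `ℓ^∞ → ℓ^∞` norm in which kernel bounds compose.

HONEST SCOPE.  (i) First entry of (1.110) only (no `∇G`, `G∇*`, `ΔG`, no Hölder statements); (ii) unit cubes
`Δ = B` in place of the printed doubled cubes `Δ̃`, block (sup-norm torus) distance between the blocks of the row
and column sites; (iii) `a = 1`, `U = 1`, finite torus; (iv) constants and rates crude and ours, the admissible
weight rate `δ′` strictly below both rates of `B5G183FreeRowSum` (no optimisation); nothing printed is matched;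
(v) 0 def (pieces and phase fields written inline).  NEAREST TREE NEIGHBOURS: `B5G183FreeRowSum` (the `J`-form
per block), `B5G115SupBound` / `B5G115RowSum` (global, unweighted), `B6KernelComposition` (abstract composition of
kernels in weighted row-sum currency — a prospective consumer, nothing of it used).  Unit `b2b-balaban-pv15-g12`
(PV15 cell lineage, generation 12).
-/

open scoped BigOperators Matrix ComplexConjugate Real
open Finset Complex Matrix

namespace Literature.MathematicalPhysics.QuantumFieldTheory.Balaban1983to89.B5G110BlockRowSum

open Literature.MathematicalPhysics.QuantumFieldTheory.Balaban1983to89.B5Prop11Plancherel (Tor fine)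
open Literature.MathematicalPhysics.QuantumFieldTheory.Balaban1983to89.B4TorusKernel (periodConst)
open Literature.MathematicalPhysics.QuantumFieldTheory.Balaban1983to89.B4TorusKernel.MultiPeriod (torusSupNorm)
open Literature.MathematicalPhysics.QuantumFieldTheory.Balaban1983to89.B5Block118 (bpt)
open Literature.MathematicalPhysics.QuantumFieldTheory.Balaban1983to89.B5Blocks16 (blockOf_bpt)
open Literature.MathematicalPhysics.QuantumFieldTheory.Balaban1983to89.B5DeltaA169 (DeltaA)
open Literature.MathematicalPhysics.QuantumFieldTheory.Balaban1983to89.B5G183Strip (kappa183 kappa183_pos)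
open Literature.MathematicalPhysics.QuantumFieldTheory.Balaban1983to89.B5G183CovDecay (MD183 MD183_nonneg)
open Literature.MathematicalPhysics.QuantumFieldTheory.Balaban1983to89.B5Kernel166Decay (periodConst_pos)
open Literature.MathematicalPhysics.QuantumFieldTheory.Balaban1983to89.B6LowerBound2153Torus (toT rep toT_rep)
open Literature.MathematicalPhysics.QuantumFieldTheory.Balaban1983to89.B4Sect5Proof (latticeConst latticeConst_nonneg)
open Literature.MathematicalPhysics.QuantumFieldTheory.Balaban1983to89.B5Hk163TorusHolderRate
  (sum_exp_torusSupNorm_sub_rep_le)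
open Literature.MathematicalPhysics.QuantumFieldTheory.Balaban1983to89.B5G183FreeRowSum
  (norm_DeltaA_one_inv_mulVec_le_uniform)
open Literature.MathematicalPhysics.QuantumFieldTheory.Balaban1983to89.B5G115SupBound (exists_eq_bpt_blockOf
  piece_supp)

noncomputable section

variable {d : ℕ}

/-! ## §1 The block swap -/

section Swap

variable (n : ℕ) [NeZero n] (M : Fin (d + 1) → ℕ) [hM : ∀ μ, NeZero (M μ)]

/-- summing a block weight against a function over the fine torus, block by block:
`Σ_j w(blockOf j)·F(j) = Σ_{y′ ∈ T₁} w(y′)·Σ_j 1_{B(y′)}(j)·F(j)`. [folklore] -/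
theorem sum_blockOf_mul (w : Tor M → ℝ) (F : Tor (fine n M) × Fin (d + 1) → ℝ) :
    ∑ j, w (B5Blocks16.blockOf n M j.1) * F j
      = ∑ y' : Tor M, w y' * ∑ j, (if B5Blocks16.blockOf n M j.1 = y' then F j else 0) := by
  simp_rw [Finset.mul_sum, mul_ite, mul_zero]
  rw [Finset.sum_comm]
  refine Finset.sum_congr rfl fun j _ => ?_
  rw [Finset.sum_ite_eq]
  simp

end Swap

/-! ## §2 Per-block `ℓ¹` row sums: (1.110), first entry, row-sum currency -/

section Block

variable (n : ℕ) [NeZero n] (hn : 1 ≤ n) (M : Fin (d + 1) → ℕ) [hM : ∀ μ, NeZero (M μ)]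

include hn in
/-- **(1.110), first entry, as decaying per-block `ℓ¹` row sums of `G = Δ_1⁻¹`**: for the row
`i = (n·y + r, μ)` and every block `B(y′)`,
`Σ_j 1_{B(y′)}(j)·|G(i,j)| ≤ C₁e^{−δ₁|y−y′|_{T₁,∞}} + (d+1)·C₂e^{−δ₂|y−y′|_{T₁,∞}}`
(`δ₁ = 1/(2(d+1))`, `C₁ = 2N·2^N·e^{δ₁}`, `δ₂ = κ₁₈₃(d+1)/(d+1)`, `C₂ = MD183·periodConst`): the localized operator
bound `B5G183FreeRowSum.norm_DeltaA_one_inv_mulVec_le_uniform` tested against the phase field of the row restricted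
to `B(y′)`.  (Location of the printed text: `Balaban1984PropagatorsI` p. 35, (1.110); the typed inequality, with
unit cubes and our constants, is not a quotation.) [folklore] -/
theorem block_row_sum_le {Nn : ℕ} (hN : d + 1 ≤ Nn + 1) (y y' : Tor M) (r : Fin (d + 1) → Fin n)
    (μ : Fin (d + 1)) :
    ∑ j, (if B5Blocks16.blockOf n M j.1 = y' then ‖(DeltaA n M 1)⁻¹ (bpt n M y r, μ) j‖ else 0)
      ≤ 2 * Nn * 2 ^ Nn * Real.exp (1 / (2 * (d + 1)))
            * Real.exp (-(1 / (2 * (d + 1)) * torusSupNorm M (rep M y - rep M y')))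
        + (d + 1) * (MD183 (d + 1) Nn * periodConst (kappa183 (d + 1)) d
            * Real.exp (-(kappa183 (d + 1) / (d + 1) * torusSupNorm M (rep M y - rep M y')))) := by
  set A : Matrix (Tor (fine n M) × Fin (d + 1)) (Tor (fine n M) × Fin (d + 1)) ℂ := (DeltaA n M 1)⁻¹ with hA
  set i : Tor (fine n M) × Fin (d + 1) := (bpt n M y r, μ) with hi
  -- the phase field of row `i`, restricted to the block `B(y′)`
  set J : Tor (fine n M) × Fin (d + 1) → ℂ :=
    fun j => if B5Blocks16.blockOf n M j.1 = y' then conj (A i j) / (‖A i j‖ : ℂ) else 0 with hJ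
  have hphase : ∀ j, ‖conj (A i j) / (‖A i j‖ : ℂ)‖ ≤ 1 := fun j => by
    rw [norm_div, Complex.norm_conj, Complex.norm_real, Real.norm_of_nonneg (norm_nonneg _)]
    exact div_self_le_one _
  have hJB : ∀ j, ‖J j‖ ≤ 1 := fun j => by
    simp only [hJ]
    split_ifs
    · exact hphase j
    · simp
  have hsupp : ∀ j, J j ≠ 0 → ∃ r' : Fin (d + 1) → Fin n, j.1 = bpt n M (toT M (rep M y')) r' :=
    fun j hj => piece_supp n M (fun j => conj (A i j) / (‖A i j‖ : ℂ)) y' j hj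
  -- testing: `(A J)(i) = Σ_j 1_{B(y′)}(j) |A(i,j)|`
  have htest : (A *ᵥ J) i
      = ((∑ j, (if B5Blocks16.blockOf n M j.1 = y' then ‖A i j‖ else 0) : ℝ) : ℂ) := by
    simp only [Matrix.mulVec, dotProduct, hJ]
    rw [Complex.ofReal_sum]
    refine Finset.sum_congr rfl fun j _ => ?_
    split_ifs with hb
    · rw [mul_div_assoc', Complex.mul_conj, Complex.normSq_eq_norm_sq]
      rcases eq_or_ne (A i j) 0 with h | h
      · simp [h]
      · have hz : (‖A i j‖ : ℂ) ≠ 0 := by exact_mod_cast norm_ne_zero_iff.mpr h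
        push_cast
        rw [pow_two, mul_div_assoc, div_self hz, mul_one]
    · simp
  have h := norm_DeltaA_one_inv_mulVec_le_uniform n hn M hN (rep M y) (rep M y') J hJB hsupp r μ
  rw [toT_rep, one_mul, ← hi, ← hA, htest, Complex.norm_real,
    Real.norm_of_nonneg (Finset.sum_nonneg fun j _ => by split_ifs <;> simp)] at h
  exact h

end Block

/-! ## §3 Exponentially weighted row sums, uniform in `n` and in the torus -/

section Weighted

variable (n : ℕ) [NeZero n] (hn : 1 ≤ n) (M : Fin (d + 1) → ℕ) [hM : ∀ μ, NeZero (M μ)]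

include hn in
/-- **WEIGHTED ROW SUMS of `G = Δ_1⁻¹` at block points**: for every rate `δ′ < min(δ₁, δ₂)` (e.g. `0 ≤ δ′ < min(δ₁, δ₂)`) and the row
`i = (n·y + r, μ)`,
`Σ_j e^{δ′|y − blockOf(j)|_{T₁,∞}} |G(i,j)| ≤ C₁·K_{d+1}(δ₁ − δ′) + (d+1)·C₂·K_{d+1}(δ₂ − δ′)`,
`K = latticeConst`, every constant a function of `d`, `N`, `δ′` — UNIFORM in `n = L^k` and in the torus.
(Location of the printed text: `Balaban1984PropagatorsI` p. 35 (1.110) / p. 36 (1.115), first entries; the typed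
inequality is ours, not a quotation.) [folklore] -/
theorem weighted_row_sum_le {Nn : ℕ} (hN : d + 1 ≤ Nn + 1) {δ' : ℝ}
    (h₁ : δ' < 1 / (2 * (d + 1))) (h₂ : δ' < kappa183 (d + 1) / (d + 1))
    (y : Tor M) (r : Fin (d + 1) → Fin n) (μ : Fin (d + 1)) :
    ∑ j, Real.exp (δ' * torusSupNorm M (rep M y - rep M (B5Blocks16.blockOf n M j.1)))
          * ‖(DeltaA n M 1)⁻¹ (bpt n M y r, μ) j‖
      ≤ 2 * Nn * 2 ^ Nn * Real.exp (1 / (2 * (d + 1))) * latticeConst (d + 1) (1 / (2 * (d + 1)) - δ')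
        + (d + 1) * (MD183 (d + 1) Nn * periodConst (kappa183 (d + 1)) d
            * latticeConst (d + 1) (kappa183 (d + 1) / (d + 1) - δ')) := by
  have hC₁ : (0 : ℝ) ≤ 2 * Nn * 2 ^ Nn * Real.exp (1 / (2 * (d + 1))) := by positivity
  have hC₂ : (0 : ℝ) ≤ MD183 (d + 1) Nn * periodConst (kappa183 (d + 1)) d :=
    mul_nonneg (MD183_nonneg _ _) (periodConst_pos (kappa183_pos _) _).le
  have hd : (0 : ℝ) ≤ d + 1 := by positivity
  -- block swap
  rw [sum_blockOf_mul n M (fun y' => Real.exp (δ' * torusSupNorm M (rep M y - rep M y')))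
    (fun j => ‖(DeltaA n M 1)⁻¹ (bpt n M y r, μ) j‖)]
  -- per block: weight × decaying block row sum = decay at the reduced rates
  have hblock : ∀ y' : Tor M,
      Real.exp (δ' * torusSupNorm M (rep M y - rep M y'))
          * ∑ j, (if B5Blocks16.blockOf n M j.1 = y' then ‖(DeltaA n M 1)⁻¹ (bpt n M y r, μ) j‖ else 0)
        ≤ 2 * Nn * 2 ^ Nn * Real.exp (1 / (2 * (d + 1)))
              * Real.exp (-((1 / (2 * (d + 1)) - δ') * torusSupNorm M (rep M y - rep M y')))
          + (d + 1) * (MD183 (d + 1) Nn * periodConst (kappa183 (d + 1)) d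
              * Real.exp (-((kappa183 (d + 1) / (d + 1) - δ') * torusSupNorm M (rep M y - rep M y')))) := by
    intro y'
    set T := torusSupNorm M (rep M y - rep M y') with hT
    have hw : 0 ≤ Real.exp (δ' * T) := (Real.exp_pos _).le
    have e₁ : Real.exp (δ' * T) * Real.exp (-(1 / (2 * (d + 1)) * T))
        = Real.exp (-((1 / (2 * (d + 1)) - δ') * T)) := by
      rw [← Real.exp_add]; ring_nf
    have e₂ : Real.exp (δ' * T) * Real.exp (-(kappa183 (d + 1) / (d + 1) * T))
        = Real.exp (-((kappa183 (d + 1) / (d + 1) - δ') * T)) := by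
      rw [← Real.exp_add]; ring_nf
    calc Real.exp (δ' * T)
          * ∑ j, (if B5Blocks16.blockOf n M j.1 = y' then ‖(DeltaA n M 1)⁻¹ (bpt n M y r, μ) j‖ else 0)
        ≤ Real.exp (δ' * T) * (2 * Nn * 2 ^ Nn * Real.exp (1 / (2 * (d + 1)))
              * Real.exp (-(1 / (2 * (d + 1)) * T))
            + (d + 1) * (MD183 (d + 1) Nn * periodConst (kappa183 (d + 1)) d
              * Real.exp (-(kappa183 (d + 1) / (d + 1) * T)))) :=
          mul_le_mul_of_nonneg_left (block_row_sum_le n hn M hN y y' r μ) hw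
      _ = 2 * Nn * 2 ^ Nn * Real.exp (1 / (2 * (d + 1))) * (Real.exp (δ' * T) * Real.exp (-(1 / (2 * (d + 1)) * T)))
            + (d + 1) * (MD183 (d + 1) Nn * periodConst (kappa183 (d + 1)) d
              * (Real.exp (δ' * T) * Real.exp (-(kappa183 (d + 1) / (d + 1) * T)))) := by ring
      _ = _ := by rw [e₁, e₂]
  -- the two uniform torus sums at the reduced rates
  have hS₁ : ∑ y' : Tor M, Real.exp (-((1 / (2 * (d + 1)) - δ') * torusSupNorm M (rep M y - rep M y')))
      ≤ latticeConst (d + 1) (1 / (2 * (d + 1)) - δ') :=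
    sum_exp_torusSupNorm_sub_rep_le M (sub_pos.mpr h₁) (rep M y)
  have hS₂ : ∑ y' : Tor M,
      Real.exp (-((kappa183 (d + 1) / (d + 1) - δ') * torusSupNorm M (rep M y - rep M y')))
      ≤ latticeConst (d + 1) (kappa183 (d + 1) / (d + 1) - δ') :=
    sum_exp_torusSupNorm_sub_rep_le M (sub_pos.mpr h₂) (rep M y)
  calc ∑ y' : Tor M, Real.exp (δ' * torusSupNorm M (rep M y - rep M y'))
          * ∑ j, (if B5Blocks16.blockOf n M j.1 = y' then ‖(DeltaA n M 1)⁻¹ (bpt n M y r, μ) j‖ else 0)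
      ≤ ∑ y' : Tor M, (2 * Nn * 2 ^ Nn * Real.exp (1 / (2 * (d + 1)))
              * Real.exp (-((1 / (2 * (d + 1)) - δ') * torusSupNorm M (rep M y - rep M y')))
          + (d + 1) * (MD183 (d + 1) Nn * periodConst (kappa183 (d + 1)) d
              * Real.exp (-((kappa183 (d + 1) / (d + 1) - δ') * torusSupNorm M (rep M y - rep M y'))))) :=
        Finset.sum_le_sum fun y' _ => hblock y'
    _ = 2 * Nn * 2 ^ Nn * Real.exp (1 / (2 * (d + 1)))
            * ∑ y' : Tor M, Real.exp (-((1 / (2 * (d + 1)) - δ') * torusSupNorm M (rep M y - rep M y')))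
        + (d + 1) * (MD183 (d + 1) Nn * periodConst (kappa183 (d + 1)) d
            * ∑ y' : Tor M,
                Real.exp (-((kappa183 (d + 1) / (d + 1) - δ') * torusSupNorm M (rep M y - rep M y')))) := by
        simp only [Finset.mul_sum, Finset.sum_add_distrib]
    _ ≤ _ := by gcongr

include hn in
/-- **WEIGHTED ROW SUMS of `G = Δ_1⁻¹`, every row**: for every `δ′ < min(δ₁, δ₂)` and every `i = (x, μ)`,
`Σ_j e^{δ′|blockOf(x) − blockOf(j)|_{T₁,∞}} |G(i,j)| ≤ C₁·K_{d+1}(δ₁ − δ′) + (d+1)·C₂·K_{d+1}(δ₂ − δ′)` — the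
exponentially weighted `ℓ^∞ → ℓ^∞` norm of Bałaban's covariant propagator at `a = 1`, `U = 1`, bounded by a function
of `d`, `N`, `δ′` alone, uniformly in `n = L^k` and in the torus. [folklore] -/
theorem weighted_row_sum_le' {Nn : ℕ} (hN : d + 1 ≤ Nn + 1) {δ' : ℝ}
    (h₁ : δ' < 1 / (2 * (d + 1))) (h₂ : δ' < kappa183 (d + 1) / (d + 1))
    (i : Tor (fine n M) × Fin (d + 1)) :
    ∑ j, Real.exp (δ' * torusSupNorm M
            (rep M (B5Blocks16.blockOf n M i.1) - rep M (B5Blocks16.blockOf n M j.1)))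
          * ‖(DeltaA n M 1)⁻¹ i j‖
      ≤ 2 * Nn * 2 ^ Nn * Real.exp (1 / (2 * (d + 1))) * latticeConst (d + 1) (1 / (2 * (d + 1)) - δ')
        + (d + 1) * (MD183 (d + 1) Nn * periodConst (kappa183 (d + 1)) d
            * latticeConst (d + 1) (kappa183 (d + 1) / (d + 1) - δ')) := by
  obtain ⟨t, μ⟩ := i
  obtain ⟨r, hr⟩ := exists_eq_bpt_blockOf n M t
  have h := weighted_row_sum_le n hn M hN h₁ h₂ (B5Blocks16.blockOf n M t) r μ
  rwa [← hr] at h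

end Weighted

end

end Literature.MathematicalPhysics.QuantumFieldTheory.Balaban1983to89.B5G110BlockRowSum
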